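import Summits.PneNP.PneNP.Theorems.ConvexRankGatesConvexGateBlindXorDefs

/-!
# `ExactLifting`: in a MIXED one-sided junta factorisation the anchor is junta-summed on one side

Support file for crux `ConvexGateBlind` (stmt-PneNP-10680), line `xor-door-perfect-completeness`, open stub
`stub_exactLifting` (prover seat 0, session 18; companion of `…ExactLiftingAnchoredOneSided.lean`).

After `no_oneSidedJunta_shift_of` (isotropic anchor, mixed sides) and `no_colJuntaTerms_anchor_of` /
`no_rowJuntaTerms_anchor_of` (arbitrary anchor, one-sided terms), the one junta-type format of an anchored factorisation
`viol_F(x[w]) = ∑_l T_l(x,w) + a(x) b(w)` not excluded is: MIXED sides (every `T_l ≥ 0` a block-`d`-junta of the table `x`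
OR a `d`-junta of the pointer `w`, its choice) with an anchor `a ⊗ b > 0` of ARBITRARY shape. This file records the one exact
constraint such a factorisation obeys for free:

* `anchor_annihilator_mul_eq_zero_of` (registered sub-goal form `anchor_annihilator_mul_eq_zero`) — for every linear functional `Θ` on table-functions vanishing on block-`d`-juntas and every
  linear functional `Θ'` on pointer-functions vanishing on `d`-juntas (`d ≥ 3`), `Θ a · Θ' b = 0`.

Equivalently (finite-dimensional duality, not formalised here): `a` lies in the linear span of the block-`d`-juntas or `b` in
the span of the `d`-juntas — the anchor is a (signed) junta-SUM on at least one side. Proof: pair the identity with the tensor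
functional `G ↦ Θ (x ↦ Θ' (G x ·))`; it kills every one-sided junta term (a column-junta term is killed inside by `Θ'`, a
row-junta term becomes a block-junta of `x` after `Θ'` and is killed by `Θ`) and it kills the lift itself (each lifted
violation indicator `1[x_{S_C}[w_{S_C}] violates C]` is a `3`-junta of `w`), leaving `Θ a · Θ' b = 0`. No pseudo-expectation,
no unsatisfiability and no positivity is used: this is pure linear algebra of the format, valid for every `F`, `t`, size.

Use (session memo ANALYSIS9 §2): on the XOR core it lets one assume the adversary's column factor has Fourier degree `≤ d`,
after which the LP-dual certificates excluding the format are "bi-pseudo-densities" whose rows are perfect level-`d`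
pseudo-densities of the sign-shifted systems.
-/

set_option linter.dupNamespace false -- `Summit.PneNP.PneNP.…`: summit = sub-problem (D-0017)

namespace Summit.PneNP.PneNP.Theorems.XorDoor

open scoped BigOperators
open Finset

noncomputable section

/-- **In a mixed one-sided junta factorisation with an anchor, the anchor is annihilated on one side.** Let
`viol_F(x[w]) = ∑_l T_l(x, w) + a(x) b(w)` where every term `T_l` is either a block-junta of the table for every fixed
pointer (depends only on `x i`, `i ∈ S l`) or a junta of the pointer for every fixed table (only on `w i`, `i ∈ S l`),
`#(S l) ≤ d`, `3 ≤ d`. Then for every linear functional `Θ` on table-functions vanishing on all block-`d`-juntas and every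
linear functional `Θ'` on pointer-functions vanishing on all `d`-juntas, `Θ a * Θ' b = 0`. (No sign, size or satisfiability
hypothesis: linear algebra of the format.) -/
theorem anchor_annihilator_mul_eq_zero_of {m d t : ℕ} (F : Finset (Pool m)) (hd : 3 ≤ d)
    {L : Type} [Fintype L] (S : L → Finset (Fin m)) (hS : ∀ l, (S l).card ≤ d)
    (T : L → (Fin m → Fin t → ZMod 2) → (Fin m → Fin t) → ℝ)
    (hT : ∀ l, (∀ (w : Fin m → Fin t) (x x' : Fin m → Fin t → ZMod 2),
                  (∀ i ∈ S l, x i = x' i) → T l x w = T l x' w) ∨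
               (∀ (x : Fin m → Fin t → ZMod 2) (w w' : Fin m → Fin t),
                  (∀ i ∈ S l, w i = w' i) → T l x w = T l x w'))
    (a : (Fin m → Fin t → ZMod 2) → ℝ) (b : (Fin m → Fin t) → ℝ)
    (hfact : ∀ (x : Fin m → Fin t → ZMod 2) (w : Fin m → Fin t),
        (viol F (fun i => x i (w i)) : ℝ) = ∑ l, T l x w + a x * b w)
    (Θ : ((Fin m → Fin t → ZMod 2) → ℝ) →ₗ[ℝ] ℝ)
    (hΘ : ∀ (S₀ : Finset (Fin m)), S₀.card ≤ d → ∀ f : (Fin m → Fin t → ZMod 2) → ℝ,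
      (∀ x x' : Fin m → Fin t → ZMod 2, (∀ i ∈ S₀, x i = x' i) → f x = f x') → Θ f = 0)
    (Θ' : ((Fin m → Fin t) → ℝ) →ₗ[ℝ] ℝ)
    (hΘ' : ∀ (S₀ : Finset (Fin m)), S₀.card ≤ d → ∀ g : (Fin m → Fin t) → ℝ,
      (∀ w w' : Fin m → Fin t, (∀ i ∈ S₀, w i = w' i) → g w = g w') → Θ' g = 0) :
    Θ a * Θ' b = 0 := by
  classical
  -- the tensor functional `Φ G = Θ (x ↦ Θ' (G x ·))`, written out on the three pieces of the identity
  -- (1) the lift is killed: each violation indicator is a `3`-junta of the pointer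
  have hlift : Θ (fun (x : Fin m → Fin t → ZMod 2) => Θ' (fun (w : Fin m → Fin t) => (viol F (fun i => x i (w i)) : ℝ))) = 0 := by
    have hin : ∀ x : Fin m → Fin t → ZMod 2, Θ' (fun (w : Fin m → Fin t) => (viol F (fun i => x i (w i)) : ℝ)) = 0 := by
      intro x
      have hsum : (fun (w : Fin m → Fin t) => (viol F (fun i => x i (w i)) : ℝ))
          = ∑ e ∈ F, fun (w : Fin m → Fin t) => if Sat (fun i => x i (w i)) e then (0 : ℝ) else 1 := by
        funext w
        simp only [viol, Finset.sum_apply]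
        rw [Finset.card_filter]
        push_cast
        refine Finset.sum_congr rfl fun e _ => ?_
        split_ifs <;> simp
      rw [hsum, map_sum]
      refine Finset.sum_eq_zero fun e _ => hΘ' ({e.1, e.2.1, e.2.2.1} : Finset (Fin m)) ?_ _ fun w w' hww' => ?_
      · exact (Finset.card_le_three).trans hd
      · have h1 : w e.1 = w' e.1 := hww' _ (by simp)
        have h2 : w e.2.1 = w' e.2.1 := hww' _ (by simp)
        have h3 : w e.2.2.1 = w' e.2.2.1 := hww' _ (by simp)
        have hiff : Sat (fun i => x i (w i)) e ↔ Sat (fun i => x i (w' i)) e := by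
          simp only [Sat, h1, h2, h3]
        by_cases hs : Sat (fun i => x i (w i)) e
        · rw [if_pos hs, if_pos (hiff.mp hs)]
        · rw [if_neg hs, if_neg (fun h => hs (hiff.mpr h))]
    have : (fun (x : Fin m → Fin t → ZMod 2) => Θ' (fun (w : Fin m → Fin t) => (viol F (fun i => x i (w i)) : ℝ))) = 0 := funext hin
    rw [this, map_zero]
  -- (2) every one-sided junta term is killed
  have hterm : ∀ l, Θ (fun (x : Fin m → Fin t → ZMod 2) => Θ' (fun (w : Fin m → Fin t) => T l x w)) = 0 := by
    intro l
    rcases hT l with hrow | hcol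
    · -- row-junta: after `Θ'` it is a block-junta of `x`
      exact hΘ (S l) (hS l) _ fun x x' hxx' => by
        have : (fun (w : Fin m → Fin t) => T l x w) = fun w => T l x' w := funext fun w => hrow w x x' hxx'
        rw [this]
    · -- column-junta: killed inside by `Θ'`
      have : (fun (x : Fin m → Fin t → ZMod 2) => Θ' (fun (w : Fin m → Fin t) => T l x w)) = 0 := funext fun x => hΘ' (S l) (hS l) _ (hcol x)
      rw [this, map_zero]
  -- (3) pair the identity with the tensor functional
  have hid : (fun (x : Fin m → Fin t → ZMod 2) => Θ' (fun (w : Fin m → Fin t) => (viol F (fun i => x i (w i)) : ℝ)))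
      = ∑ l, (fun (x : Fin m → Fin t → ZMod 2) => Θ' (fun (w : Fin m → Fin t) => T l x w)) + Θ' b • a := by
    funext x
    have hx : (fun (w : Fin m → Fin t) => (viol F (fun i => x i (w i)) : ℝ))
        = ∑ l, (fun (w : Fin m → Fin t) => T l x w) + a x • b := by
      funext w
      simp only [Finset.sum_apply, Pi.add_apply, Pi.smul_apply, smul_eq_mul]
      exact hfact x w
    rw [hx, map_add, map_sum, map_smul]
    simp only [Finset.sum_apply, Pi.add_apply, Pi.smul_apply, smul_eq_mul]
    ring
  have h := congrArg Θ hid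
  rw [hlift, map_add, map_sum, map_smul, Finset.sum_eq_zero (fun l _ => hterm l), zero_add, smul_eq_mul] at h
  linarith [h]


/-- **The anchor of a mixed one-sided junta factorisation is annihilated on one side** — registered sub-goal
`anchor_annihilator_mul_eq_zero` of stmt-PneNP-10680, verbatim signature (see `anchor_annihilator_mul_eq_zero_of`). -/
theorem anchor_annihilator_mul_eq_zero :
    ∀ {m d t : ℕ} (F : Finset (Pool m)), 3 ≤ d → ∀ {L : Type} [Fintype L] (S : L → Finset (Fin m)), (∀ l, (S
    l).card ≤ d) → ∀ (T : L → (Fin m → Fin t → ZMod 2) → (Fin m → Fin t) → ℝ), (∀ l, (∀ (w : Fin m → Fin t) (x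
    x' : Fin m → Fin t → ZMod 2), (∀ i ∈ S l, x i = x' i) → T l x w = T l x' w) ∨ (∀ (x : Fin m → Fin t → ZMod
    2) (w w' : Fin m → Fin t), (∀ i ∈ S l, w i = w' i) → T l x w = T l x w')) → ∀ (a : (Fin m → Fin t → ZMod 2)
    → ℝ) (b : (Fin m → Fin t) → ℝ), (∀ (x : Fin m → Fin t → ZMod 2) (w : Fin m → Fin t), (viol F (fun i => x i
    (w i)) : ℝ) = ∑ l, T l x w + a x * b w) → ∀ (Θ : ((Fin m → Fin t → ZMod 2) → ℝ) →ₗ[ℝ] ℝ), (∀ (S₀ : Finset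
    (Fin m)), S₀.card ≤ d → ∀ f : (Fin m → Fin t → ZMod 2) → ℝ, (∀ x x' : Fin m → Fin t → ZMod 2, (∀ i ∈ S₀, x
    i = x' i) → f x = f x') → Θ f = 0) → ∀ (Θ' : ((Fin m → Fin t) → ℝ) →ₗ[ℝ] ℝ), (∀ (S₀ : Finset (Fin m)),
    S₀.card ≤ d → ∀ g : (Fin m → Fin t) → ℝ, (∀ w w' : Fin m → Fin t, (∀ i ∈ S₀, w i = w' i) → g w = g w') →
    Θ' g = 0) → Θ a * Θ' b = 0 :=
  fun F hd _ _ S hS T hT a b hfact Θ hΘ Θ' hΘ' =>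
    anchor_annihilator_mul_eq_zero_of F hd S hS T hT a b hfact Θ hΘ Θ' hΘ'

end

end Summit.PneNP.PneNP.Theorems.XorDoor
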